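import Literature.NumberTheory.GaloisRepresentations.RestrictedRamificationSUnitsLayerSurjectivityTwo
import Literature.NumberTheory.GaloisRepresentations.RestrictedRamificationSUnitsLayerInjectivityTwo
import Literature.NumberTheory.GaloisRepresentations.RestrictedRamificationSUnitsLayerSupplyTwo
import Literature.NumberTheory.GaloisRepresentations.IdeleSUnitsCohomologyDegreeTwo
import Literature.NumberTheory.GaloisRepresentations.IdeleClassBarInvariant
import HarnessLib

/-!
# Local invariants of the layer classes `H²(Gal(E/F₀), 𝒪_{E,S}ˣ)`: sum zero, stable under inflation, and EVERY
# sum-zero `p`-torsion family of invariants is realised in a bigger layer of `K_S`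
# (Neukirch–Schmidt–Wingberg (8.3.11) (ii)/(iii): `H²(G_S, 𝒪_S^×)(p) ≅ ker(⊕_{v∈S} ℚ_p/ℤ_p →Σ ℚ_p/ℤ_p)`, finite-layer form)

Topic `NumberTheory/GaloisRepresentations`; namespace `Literature.NumberTheory.GaloisRepresentations.SUnits.Layers`.
THEOREMS ONLY (no definition, no named fact, no `sorry`, no instance; D-0026).  Lane «TATE-EPC-TC» of cell `bsd-eis`
(crux `GoodLatticeBDPValue`, stmt-BirchSwinnertonDyer-19032; brick (F2-exact), finite-layer half), the input of the exact
count `#H²(U, E_S)[p] = p^{#S₀ − 1}` (sequel `SUnitsRestrictedCohomologyDegreeTwoTorsionCount`).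

SETTING: `K` a TOTALLY COMPLEX number field, `S` a set of finite places, `F₀ ≤ E ⊆ K_S = K̄^{N_S}` intermediate fields
of `K̄/K` with `E/K` finite Galois and `F₀` a number field, `S₀` the finite set of places of `F₀` above `S` (`hSF`); for a
class `c ∈ H²(Gal(E/F₀), 𝒪_{E,S}ˣ)` (`SUnits.sUnitsRep K S F₀ E`) write `ι c ∈ H²(Gal(E/F₀), J_{E,S₀})` for its image
under -w4's bridge `IdeleCohomology.sUnitsToIdeleS` and `inv_v(ι c)` (`v` a finite place of `F₀`) for the tree's local
invariant of its image in `H²(Gal(E/F₀), J_E)` (`IdeleCohomology.localInv`, `ideleSRepHom`).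

* §1 `sum_localInv_eq_zero` — **`Σ_{v ∈ S₀} inv_v(ι c) = 0`**: `𝒪ˣ → J_{S₀} → C_E` vanishes
  (`sUnitsToIdeleS_comp_ideleSToClass`), the global invariant of a class from `J_{E,S₀}` is the sum of its local
  invariants at `S₀` over a totally complex base ((A3b) `classInvAll_map_ideleSToClass_eq_sum`), the invariants off `S₀`
  vanish ((A3a) `localInv_map_ideleSRepHom_eq_zero_of_notMem`; `E/F₀` unramified outside `S₀`).
* §2 `localInv_layerInf` — **`inv_v(ι (Inf c)) = inv_v(ι c)`** for a bigger layer `E ≤ E'` (the squares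
  `layerInf_eq_sUnitsRepInf`, `sUnitsRepInf_comp_map_sUnitsBridge`, `map_sUnitsIdeleι_sUnitsIdeleInf`,
  `map_ideleSRepHom_ideleSInf` and `localInv_ideleInf`).
* §3 `exists_layer_realisation` — **REALISATION**: if `p ∣ n_v(E)` for every `v ∈ S₀` (a cyclotomic layer,
  `exists_cyclotomicLayer`), then every family `(a_v)_{v ∈ S₀}` with `p • a_v = 0` and `Σ_v a_v = 0` is the invariant
  family of `ι z` for some `z ∈ H²(Gal(E'/F₀), 𝒪_{E',S}ˣ)` in a bigger layer `E'`, and `p • z` dies in a still bigger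
  layer: realise `(a_v)` in `H²(Gal(E/F₀), J_{E,S₀})` ((A3a) `exists_forall_mem_localInv_eq`), kill its image in
  `H²(C_E)` by `inv_E = Σ_v inv_v` (`classInvAll_injective`), lift after capitulation (-w4's SURJECTIVITY SUPPLY
  `exists_layer_map_sUnitsToIdeleS_eq_ideleSInf_of_map_ideleSToClass_eq_zero`), and kill `p • z` by (A3a) joint
  injectivity + -w4's INJECTIVITY SUPPLY `exists_layerInf_two_eq_zero_of_map_sUnitsToIdeleS_eq_zero`.

HONEST FRAMING: finite-layer bookkeeping on landed theorems; no statement of a Summit, not Tate's formula, not the crux is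
proved here; 0 cells / labels / tiers move.

## References
* J. Neukirch, A. Schmidt, K. Wingberg, *Cohomology of Number Fields*, 2nd ed. (2008), VIII §3 (8.3.10)–(8.3.11) and
  proof. [NeukirchSchmidtWingberg2008]
* J. W. S. Cassels, A. Fröhlich (eds.), *Algebraic Number Theory* (1967), Ch. VII (J. Tate) §7.3 Cor. 7.4, §8, §11.2.
  [CasselsFrohlichANT1967]
* D. Harari, *Galois Cohomology and Class Field Theory* (2020), Prop. 13.1, Lemma 15.39, §17.4 (17.1). [Harari2020]
-/

noncomputable section

open NumberField IsDedekindDomain Field IntermediateField CategoryTheory groupCohomology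
open Literature.NumberTheory.GaloisRepresentations.OpenSubgroupLayer (algOfLE isScalarTower_algOfLE)
open Literature.NumberTheory.GaloisRepresentations.LocalWeilDatum
open Literature.NumberTheory.Automorphic

namespace Literature.NumberTheory.GaloisRepresentations

namespace SUnits

namespace Layers

variable {K : Type} [Field K] [NumberField K] (S : Set (HeightOneSpectrum (𝓞 K)))

/-! ### §1. The invariants of a layer class sum to zero over `S₀` -/

/-- **`Σ_{v ∈ S₀} inv_v(ι c) = 0`** for every `c ∈ H²(Gal(E/F₀), 𝒪_{E,S}ˣ)` (`K` totally complex, `E ⊆ K_S` finite Galois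
over `K`, `S₀` the places of `F₀` above `S`): the image of `ι c` in `H²(Gal(E/F₀), C_E)` vanishes and the global invariant
is the sum of the local invariants at `S₀`. [cite: NeukirchSchmidtWingberg2008, VIII §3 (8.3.10)–(8.3.11)]
[cite: CasselsFrohlichANT1967, Ch. VII §11.2] -/
theorem sum_localInv_eq_zero [IsTotallyComplex K] {F₀ E : IntermediateField K (AlgebraicClosure K)} [NumberField F₀]
    [FiniteDimensional K E] [IsGalois K E] (hF : F₀ ≤ E) (hS : ramificationSubgroup K S ≤ galFixing K E)
    (S₀ : Finset (HeightOneSpectrum (𝓞 F₀))) (hSF : ∀ u : HeightOneSpectrum (𝓞 F₀), u ∈ S₀ ↔ u.under (𝓞 K) ∈ S)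
    (c : letI := algOfLE hF; groupCohomology (sUnitsRep K S F₀ E) 2) :
    letI := algOfLE hF
    haveI := isScalarTower_algOfLE (K := K) hF
    haveI : NumberField E := NumberField.of_module_finite K E
    haveI : IsGalois F₀ E := IsGalois.tower_top_of_isGalois K F₀ E
    ∑ v ∈ S₀, IdeleCohomology.localInv E v
      (groupCohomology.map (MonoidHom.id _) (IdeleCohomology.ideleSRepHom S₀) 2
        (groupCohomology.map (MonoidHom.id _) (IdeleCohomology.sUnitsToIdeleS (K := K) (F := F₀) (E := E) S S₀ hSF) 2 c)) =
      0 := by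
  letI := algOfLE hF
  haveI := isScalarTower_algOfLE (K := K) hF
  haveI : NumberField E := NumberField.of_module_finite K E
  haveI : IsGalois F₀ E := IsGalois.tower_top_of_isGalois K F₀ E
  haveI : IsTotallyComplex F₀ := isTotallyComplex_of_algebra K F₀
  have hunr : ∀ v : HeightOneSpectrum (𝓞 F₀), v ∉ S₀ → Algebra.IsUnramifiedIn (𝓞 E) v.asIdeal :=
    fun v hv => isUnramifiedIn_of_le_of_ramificationSubgroup_le_galFixing S hF hS v fun h' => hv ((hSF v).2 h')
  set x := groupCohomology.map (MonoidHom.id _)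
    (IdeleCohomology.sUnitsToIdeleS (K := K) (F := F₀) (E := E) S S₀ hSF) 2 c with hx
  -- the global invariant of the image of `x` in `H²(C_E)` is the sum of the local invariants at `S₀`
  have hsum := IdeleCohomology.classInvAll_map_ideleSToClass_eq_sum (F := F₀) (E := E) S₀ x
    (fun v hv => IdeleCohomology.localInv_map_ideleSRepHom_eq_zero_of_notMem S₀ hunr hv x)
  -- and that image vanishes: `𝒪ˣ → J_{S₀} → C_E` is zero
  have hcomp := congrArg (fun φ => φ c) (groupCohomology.map_id_comp
    (IdeleCohomology.sUnitsToIdeleS (K := K) (F := F₀) (E := E) S S₀ hSF) (IdeleCohomology.ideleSToClass S₀) 2)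
  simp only [IdeleCohomology.sUnitsToIdeleS_comp_ideleSToClass, ModuleCat.hom_comp, LinearMap.coe_comp,
    Function.comp_apply] at hcomp
  have h0 : groupCohomology.map (MonoidHom.id _) (IdeleCohomology.ideleSToClass S₀) 2 x = 0 := by
    rw [hx, ← hcomp]
    change ((groupCohomology.functor ℤ (E ≃ₐ[F₀] E) 2).map (0 : sUnitsRep K S F₀ E ⟶ _)) c = 0
    rw [Functor.map_zero]
    rfl
  rw [h0, map_zero] at hsum
  exact hsum.symm

/-! ### §2. The invariants are stable under inflation to a bigger layer -/

/-- **`inv_v(ι (Inf c)) = inv_v(ι c)`** for layers `F₀ ≤ E ≤ E' ⊆ K̄` (`E`, `E'` finite Galois over `K`) and every finite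
place `v` of `F₀`: the bridge, the inclusion `J_{·,S₀} ⊆ J_·` and the local invariants commute with inflation.
[cite: CasselsFrohlichANT1967, Ch. VII §11.1] [cite: NeukirchSchmidtWingberg2008, VIII §3 (8.3.11)] -/
theorem localInv_layerInf {F₀ E E' : IntermediateField K (AlgebraicClosure K)} [NumberField F₀]
    [FiniteDimensional K E] [IsGalois K E] [FiniteDimensional K E'] [IsGalois K E'] (hF : F₀ ≤ E) (hEE' : E ≤ E')
    (S₀ : Finset (HeightOneSpectrum (𝓞 F₀))) (hSF : ∀ u : HeightOneSpectrum (𝓞 F₀), u ∈ S₀ ↔ u.under (𝓞 K) ∈ S)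
    (c : letI := algOfLE hF; groupCohomology (sUnitsRep K S F₀ E) 2) (v : HeightOneSpectrum (𝓞 F₀)) :
    letI := algOfLE hF
    letI := algOfLE (hF.trans hEE')
    haveI := isScalarTower_algOfLE (K := K) hF
    haveI := isScalarTower_algOfLE (K := K) (hF.trans hEE')
    haveI : NumberField E := NumberField.of_module_finite K E
    haveI : NumberField E' := NumberField.of_module_finite K E'
    haveI : IsGalois F₀ E := IsGalois.tower_top_of_isGalois K F₀ E
    haveI : IsGalois F₀ E' := IsGalois.tower_top_of_isGalois K F₀ E'
    IdeleCohomology.localInv E' v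
      (groupCohomology.map (MonoidHom.id _) (IdeleCohomology.ideleSRepHom S₀) 2
        (groupCohomology.map (MonoidHom.id _) (IdeleCohomology.sUnitsToIdeleS (K := K) (F := F₀) (E := E') S S₀ hSF) 2
          (layerInf S hF hEE' 2 c))) =
      IdeleCohomology.localInv E v
        (groupCohomology.map (MonoidHom.id _) (IdeleCohomology.ideleSRepHom S₀) 2
          (groupCohomology.map (MonoidHom.id _) (IdeleCohomology.sUnitsToIdeleS (K := K) (F := F₀) (E := E) S S₀ hSF) 2
            c)) := by
  letI := algOfLE hF
  letI := algOfLE hEE'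
  letI := algOfLE (hF.trans hEE')
  haveI := isScalarTower_algOfLE (K := K) hF
  haveI := isScalarTower_algOfLE (K := K) (hF.trans hEE')
  haveI := isScalarTower_algOfLE₃ hF hEE'
  haveI : NumberField E := NumberField.of_module_finite K E
  haveI : NumberField E' := NumberField.of_module_finite K E'
  haveI : IsGalois F₀ E := IsGalois.tower_top_of_isGalois K F₀ E
  haveI : IsGalois F₀ E' := IsGalois.tower_top_of_isGalois K F₀ E'
  haveI := normal_algOfLE (K := K) hF
  -- `ι = bridge ≫ (principal S₀-idèles ↪ J_{S₀})`
  have hι : ∀ (L : IntermediateField K (AlgebraicClosure K)) [FiniteDimensional K L] [IsGalois K L] (hL : F₀ ≤ L)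
      (y : letI := algOfLE hL; groupCohomology (sUnitsRep K S F₀ L) 2),
      letI := algOfLE hL
      haveI := isScalarTower_algOfLE (K := K) hL
      haveI : NumberField L := NumberField.of_module_finite K L
      groupCohomology.map (MonoidHom.id _) (IdeleCohomology.sUnitsToIdeleS (K := K) (F := F₀) (E := L) S S₀ hSF) 2 y =
        groupCohomology.map (MonoidHom.id _) (IdeleCohomology.sUnitsIdeleι S₀) 2
          (groupCohomology.map (MonoidHom.id _) (IdeleCohomology.sUnitsBridge (K := K) (F := F₀) (E := L) S S₀ hSF) 2 y) := by
    intro L _ _ hL y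
    letI := algOfLE hL
    haveI := isScalarTower_algOfLE (K := K) hL
    haveI : NumberField L := NumberField.of_module_finite K L
    have h := congrArg (fun φ => φ y) (groupCohomology.map_id_comp
      (IdeleCohomology.sUnitsBridge (K := K) (F := F₀) (E := L) S S₀ hSF) (IdeleCohomology.sUnitsIdeleι S₀) 2)
    simp only [IdeleCohomology.sUnitsBridge_comp_ι, ModuleCat.hom_comp, LinearMap.coe_comp, Function.comp_apply] at h
    exact h
  -- the bridge square and the `S₀`-idèle square
  have hsq := congrArg (fun φ => φ c)
    (IdeleCohomology.sUnitsRepInf_comp_map_sUnitsBridge (K := K) (F := F₀) (E := E) (E' := E') S S₀ hSF 2)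
  simp only [ModuleCat.hom_comp, LinearMap.coe_comp, Function.comp_apply] at hsq
  rw [hι E' (hF.trans hEE') (layerInf S hF hEE' 2 c), layerInf_eq_sUnitsRepInf S hF hEE' 2, hsq,
    IdeleCohomology.map_sUnitsIdeleι_sUnitsIdeleInf, IdeleCohomology.map_ideleSRepHom_ideleSInf,
    IdeleCohomology.localInv_ideleInf, ← hι E hF c]

/-! ### §3. Realisation of a sum-zero `p`-torsion family of invariants -/

/-- **REALISATION.**  `K` totally complex, `F₀ ≤ E ⊆ K_S` with `E/K` finite Galois and `p ∣ n_v(E)` for every `v ∈ S₀`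
(`S₀` = the places of `F₀` above `S`).  Every family `(a_v)_v` of elements of `ℚ/ℤ` with `p • a_v = 0` for `v ∈ S₀` and
`Σ_{v ∈ S₀} a_v = 0` is the family of invariants at `S₀` of `ι z` for some `z ∈ H²(Gal(E'/F₀), 𝒪_{E',S}ˣ)` in a finite
Galois layer `E' ⊇ E` of `K_S`, and `p • z` dies after inflation to a further layer `E'' ⊇ E'`.
[cite: NeukirchSchmidtWingberg2008, VIII §3 (8.3.11) (ii)/(iii) (proof)] [cite: CasselsFrohlichANT1967, Ch. VII §7.3 Cor. 7.4, §11.2] -/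
theorem exists_layer_realisation [IsTotallyComplex K] {F₀ E : IntermediateField K (AlgebraicClosure K)} [NumberField F₀]
    [FiniteDimensional K E] [IsGalois K E] (hF : F₀ ≤ E) (hS : ramificationSubgroup K S ≤ galFixing K E)
    (S₀ : Finset (HeightOneSpectrum (𝓞 F₀))) (hSF : ∀ u : HeightOneSpectrum (𝓞 F₀), u ∈ S₀ ↔ u.under (𝓞 K) ∈ S)
    (p : ℕ) (hdeg : letI := algOfLE hF
      haveI : NumberField E := NumberField.of_module_finite K E
      ∀ v ∈ S₀, p ∣ IdeleCohomology.localDegree E v)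
    (a : HeightOneSpectrum (𝓞 F₀) → AddCircle (1 : ℚ)) (hap : ∀ v ∈ S₀, p • a v = 0) (hsum : ∑ v ∈ S₀, a v = 0) :
    ∃ (E' : IntermediateField K (AlgebraicClosure K)) (_ : FiniteDimensional K E') (_ : IsGalois K E') (hEE' : E ≤ E')
      (_ : ramificationSubgroup K S ≤ galFixing K E')
      (z : letI := algOfLE (hF.trans hEE'); groupCohomology (sUnitsRep K S F₀ E') 2),
      (letI := algOfLE (hF.trans hEE')
       haveI := isScalarTower_algOfLE (K := K) (hF.trans hEE')
       haveI : NumberField E' := NumberField.of_module_finite K E'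
       haveI : IsGalois F₀ E' := IsGalois.tower_top_of_isGalois K F₀ E'
       ∀ v ∈ S₀, IdeleCohomology.localInv E' v
         (groupCohomology.map (MonoidHom.id _) (IdeleCohomology.ideleSRepHom S₀) 2
           (groupCohomology.map (MonoidHom.id _)
             (IdeleCohomology.sUnitsToIdeleS (K := K) (F := F₀) (E := E') S S₀ hSF) 2 z)) = a v) ∧
      ∃ (E'' : IntermediateField K (AlgebraicClosure K)) (_ : FiniteDimensional K E'') (_ : IsGalois K E'')
        (hE'E'' : E' ≤ E'') (_ : ramificationSubgroup K S ≤ galFixing K E''),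
        layerInf S (hF.trans hEE') hE'E'' 2 (p • z) = 0 := by
  classical
  letI := algOfLE hF
  haveI := isScalarTower_algOfLE (K := K) hF
  haveI : NumberField E := NumberField.of_module_finite K E
  haveI : IsGalois F₀ E := IsGalois.tower_top_of_isGalois K F₀ E
  haveI : IsTotallyComplex F₀ := isTotallyComplex_of_algebra K F₀
  have hunr : ∀ v : HeightOneSpectrum (𝓞 F₀), v ∉ S₀ → Algebra.IsUnramifiedIn (𝓞 E) v.asIdeal :=
    fun v hv => isUnramifiedIn_of_le_of_ramificationSubgroup_le_galFixing S hF hS v fun h' => hv ((hSF v).2 h')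
  -- realise `(a_v)` in `H²(Gal(E/F₀), J_{E,S₀})`: `n_v • a_v = 0` since `p ∣ n_v` and `p • a_v = 0`
  have ha : ∀ v ∈ S₀, IdeleCohomology.localDegree E v • a v = 0 := fun v hv => by
    obtain ⟨m, hm⟩ := hdeg v hv
    rw [hm, mul_nsmul, hap v hv, nsmul_zero]
  obtain ⟨c, hc⟩ := IdeleCohomology.exists_forall_mem_localInv_eq (E := E) S₀ a ha
  -- its image in `H²(C_E)` vanishes: `inv_E = Σ_v inv_v = Σ_v a_v = 0`
  have hc0 : groupCohomology.map (MonoidHom.id _) (IdeleCohomology.ideleSToClass S₀) 2 c = 0 := by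
    apply IdeleCohomology.classInvAll_injective F₀ E
    rw [IdeleCohomology.classInvAll_map_ideleSToClass_eq_sum S₀ c
      (fun v hv => IdeleCohomology.localInv_map_ideleSRepHom_eq_zero_of_notMem S₀ hunr hv c), map_zero,
      ← hsum]
    exact Finset.sum_congr rfl fun v hv => hc v hv
  -- lift to the `S`-units after a capitulation layer `E'`
  obtain ⟨E', hfd', hgal', hEE', hS', z, hz⟩ :=
    exists_layer_map_sUnitsToIdeleS_eq_ideleSInf_of_map_ideleSToClass_eq_zero S hF hS S₀ hSF c hc0
  haveI := hfd'
  haveI := hgal'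
  letI := algOfLE hEE'
  letI := algOfLE (hF.trans hEE')
  haveI := isScalarTower_algOfLE (K := K) (hF.trans hEE')
  haveI := isScalarTower_algOfLE₃ hF hEE'
  haveI : NumberField E' := NumberField.of_module_finite K E'
  haveI : IsGalois F₀ E' := IsGalois.tower_top_of_isGalois K F₀ E'
  haveI := normal_algOfLE (K := K) hF
  have hunr' : ∀ v : HeightOneSpectrum (𝓞 F₀), v ∉ S₀ → Algebra.IsUnramifiedIn (𝓞 E') v.asIdeal :=
    fun v hv => isUnramifiedIn_of_le_of_ramificationSubgroup_le_galFixing S (hF.trans hEE') hS' v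
      fun h' => hv ((hSF v).2 h')
  refine ⟨E', hfd', hgal', hEE', hS', z, fun v hv => ?_, ?_⟩
  · -- invariants of `ι z = Inf c` are those of `c`
    rw [hz, IdeleCohomology.map_ideleSRepHom_ideleSInf, IdeleCohomology.localInv_ideleInf]
    exact hc v hv
  · -- `ι (p • z) = Inf (p • c) = 0`, so `p • z` dies in a deeper layer (injectivity supply)
    have hpc : p • c = 0 :=
      IdeleCohomology.eq_zero_of_forall_mem_localInv_eq_zero S₀ hunr (p • c) fun v hv => by
        rw [map_nsmul, map_nsmul, hc v hv, hap v hv]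
    have h0 : groupCohomology.map (MonoidHom.id _)
        (IdeleCohomology.sUnitsToIdeleS (K := K) (F := F₀) (E := E') S S₀ hSF) 2 (p • z) = 0 := by
      rw [map_nsmul, hz, ← map_nsmul, hpc, map_zero]
    obtain ⟨E'', hfd'', hgal'', hE'E'', hS'', h⟩ :=
      exists_layerInf_two_eq_zero_of_map_sUnitsToIdeleS_eq_zero S (hF.trans hEE') hS' S₀ hSF (p • z) h0
    exact ⟨E'', hfd'', hgal'', hE'E'', hS'', h⟩

end Layers

end SUnits

end Literature.NumberTheory.GaloisRepresentations

end
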